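import Summits.QuantumFields.YangMills.Theorems.BalabanUVNodesN22WindowOfLocalizedSum
import Summits.QuantumFields.YangMills.Theorems.BalabanUVNodesN22W1YoungLipschitz

/-!
# BalabanUVNodes ∕ node N22 = NE9 — THE (α)→(β′) LEG IN KERNEL CURRENCY, MODULE J30: LAW (N) OF THE JUNCTION J29 IS ROAD 1's ENGINE OUTPUT —
# the term-level history-Lipschitz bound ON THE COMPLEXIFIED PROBE BALL for node00-def-W1's (2.13) terms `ClusterStep.E` from W1's two activity-level slots
# `Bound238` + `YoungLipschitz` on the admissible spaces (the differenced (2.39)–(2.41) of [II] p. 21 in COMPLEX MODULUS, before the real part is read),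
# and J29's SOFT windowed bound of the (1.7) localized sum with (N) DISCHARGED modulo those slots

Cell `pub-ymgap`, HUMAN RULING D-0062 (Track A), R134 ACCELERATION re-seat `pub-ymgap-dag-n22-c` (strategy s1), generation 11, file J30.  THEOREMS ONLY; imports J29
`…N22WindowOfLocalizedSum` (`abs_polWindow_localizedSum_sub_le_soft`) and this seat's Road-1 engine `…N22W1YoungLipschitz` (`norm_locE_sub_locE_le_torus4`: the
differenced (2.39)–(2.41) on the torus catalogue of the papers, geometry clauses located as numerals) BY NAME.  `--supports` K3⁷ `SpineGivenEndpointR13SepCoPH`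
(stmt-QuantumFields-20544) as a helper.

WHY.  J29 displays, per term `X` of W1-20's `localizedSum F S emb`, the law (N) «`‖G_X(hist)(z) − G_X(hist′)(z)‖ ≤ M(X)` on the complexified probe ball» for the
holomorphic functions `G_X(hist) : z ↦ E^{(k+1)}(X; hist; Φ_X z)` through a complexified probe reading `Φ_X`.  THIS FILE shows that (N) is NOT a new
term-level estimate: it is the output of Road 1's history-Lipschitz engine ((2.40)–(2.41) at the W1 object, this seat's `…N22W1YoungLipschitz`) READ IN COMPLEX
MODULUS — the engine bounds `‖E^{(k+1)}(X; hist; φ) − E^{(k+1)}(X; hist′; φ)‖` for EVERY configuration pair `φ` admissible for the polymers inside `X`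
(`φ ∈ sp Z` for `Z ⊆ X`) from W1's displayed slots `Bound238 (S k) Wk sp A R` (Lemma 3 (2.38), node N10's T-row) and `YoungLipschitz (S k) Wk sp ℓ R` (the
differenced (2.38), NOT PRINTED) with Road 1's numerals; `T4OutputRate.NE9` only kept its real part.  So at a complexified probe reading `Φ_X` mapping the
ball INTO the admissible spaces, (N) holds with `M(X) = 8·e·9·64·K₀(64,8)²·e^{−κ d_{k+1}(X)}·Σ_i ℓ_i|hist_i − hist′_i|`, and J29's soft edition fires with
(N) discharged: the windowed history difference of def-B's `polWindow` of the localized sum is at most the soft two-point sum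
`Σ_X 16·M(X)·r⁻²·w_X(z·)·w_X(0·)` that dag-n22-w2's (5.10) resummation consumes.

WHAT.  §1 `norm_clusterStepE_sub_le_of_youngLipschitz` (complex-modulus young-Lipschitz bound of (2.13) `ClusterStep.E hist φ X` on configurations
admissible inside `X`); §2 `norm_clusterStepE_comp_sub_le_of_youngLipschitz` (= J29's law (N) at a complexified reading `Φ` mapping the ball into the
spaces); §3 ★ `abs_polWindow_localizedSum_sub_le_soft_of_slots` (J29's `abs_polWindow_localizedSum_sub_le_soft` with (N) supplied by §2).

HONEST FRAMING — what this is NOT.  Count-neutral junction; the ONLY estimate used is Road 1's elementary engine (already in the tree) and J28's Cauchy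
bound.  STILL DISPLAYED (hypotheses), with their owners: W1's slots `Bound238` ∕ `YoungLipschitz` at the towers of record on the admissible spaces (node
N10 ∕ NODE A — the located inputs of HOME `N22-RESIDUAL-CENSUS-g11.md`; NOT PRINTED for the differenced slot); (C1) holomorphy of the composite
`z ↦ E^{(k+1)}(X; hist; Φ_X z)` on an open `U_X ⊇ ball 0 r`; (C2) the complexified probe reading `Φ_X` itself — it extends `emb K k ∘ (exp ρ ·)` from real
probe fields and maps the ball into the admissible space of every polymer inside `X` ([I] p. 264: «𝐄^{(j+1)}(g_j, B) … can be extended to an analytic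
function on the space of complex-valued field configurations», NODE A's analytic extension of the minimizer); the site weights `w_X` of the
complexifications `ι_X` ([I] (4.35)–(4.37) pp. 290–291 tails; dag-n22-w2's road) and Road 1's numerals `hrate` ∕ `hsmall`.  Nothing of Bałaban's
constructed; N22 NOT discharged (typed 28∕28 · discharged 5∕27 UNCHANGED); NE9 NOT IN PRINT for d = 4; one finite four-torus programme at fixed ε — NOT
infinite volume, NOT OS on ℝ⁴, NOT a mass gap, NOT Clay.  0 `sorry`, 0 `def`, standard axioms.

References (TYPES only): [I] = [Balaban1987RG1] (1.7) p. 261, (1.18) p. 263, (1.20)–(1.21) p. 264, (4.35)–(4.37) pp. 290–291, (5.10) p. 293; [II] =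
[Balaban1988RG2Cluster] (2.13) p. 14, Lemma 3 (2.38) p. 20, (2.39)–(2.41) p. 21.
-/

noncomputable section

namespace YMDAG.N22.WindowOfLocalTerms

open Filter Metric Set
open scoped BigOperators Topology
open Literature.MathematicalPhysics.QuantumFieldTheory.Balaban1983to89
open Literature.MathematicalPhysics.QuantumFieldTheory.Balaban1983to89.T4Continuum (T4Family)
open Literature.MathematicalPhysics.QuantumFieldTheory.Balaban1983to89.B12PolarizationTensor120 (polTensor polComp expChart expChart_apply)
open Literature.MathematicalPhysics.QuantumFieldTheory.Balaban1983to89.B12TreeDecay (K₀ K₀_pos)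
open Literature.MathematicalPhysics.QuantumFieldTheory.Balaban1983to89.B13Resummation (locE)
open Literature.MathematicalPhysics.QuantumFieldTheory.Balaban1983to89.TreeLengthTorus (tsys torusTreeLen torusTreeLen_nonneg)
open Literature.MathematicalPhysics.QuantumFieldTheory.Balaban1983to89.TreeLengthTorusGeometry (TTouch)
open Literature.MathematicalPhysics.QuantumFieldTheory.Balaban1983to89.Node00 (polScalar polWindow siteOfInt)
open Literature.MathematicalPhysics.QuantumFieldTheory.Balaban1983to89.Node00.LocalizedSum17 (localizedSum ReadingMaps)
open Literature.MathematicalPhysics.QuantumFieldTheory.Balaban1983to89.Node00.Sect2 (domSys domCount CPair)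
open Literature.MathematicalPhysics.QuantumFieldTheory.Balaban1983to89.Node00.W1 (ClusterTower ClusterStep)
open YMDAG.N22.W1 (norm_locE_sub_locE_le_torus4)

/-! ## §1 Road 1's engine in complex modulus: the young-Lipschitz bound of the (2.13) term on configurations admissible inside `X` -/

section Engine

variable (F : T4Family) (K : ℕ) {𝔸 : Type*} {M k : ℕ}

open Classical in
/-- **THE DIFFERENCED (2.39)–(2.41) AT THE (2.13) TERM, COMPLEX MODULUS.**  For W1's one-step cluster data `S` at level `k` on the `K`-th torus, a set
`Wk` of young-coupling prefixes and space tables `sp`: W1's `Bound238 S Wk sp A R` and `YoungLipschitz S Wk sp ℓ R` (both DISPLAYED), Road 1's numerals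
`r₁ + 2·64·log 162 + 2 ≤ R`, `2A·e^{5r₁+1}·K₀(64,8)·9·64 ≤ 1`, `κ ≤ r₁`, `A > 0`, `ℓ ≥ 0` give, for two prefixes of `Wk`, every domain `X ∈ 𝐃_{k+1}` and every
configuration pair `φ` admissible for the polymers inside `X` (`φ ∈ sp Z` whenever `Z ⊆ X`),
`‖E^{(k+1)}(X; hist; φ) − E^{(k+1)}(X; hist′; φ)‖ ≤ e^{−κ d_{k+1}(X)} · 8·e·9·64·K₀(64,8)² · Σ_i ℓ_i |hist_i − hist′_i|` — the bound whose real part is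
`T4OutputRate.NE9` (`YMDAG.N22.W1.ne9_functionalOn_of_youngLipschitz`). [cite: Balaban1988RG2Cluster, (2.13) p.14, (2.38) p.20 and (2.39)-(2.41) p.21] -/
theorem norm_clusterStepE_sub_le_of_youngLipschitz (S : ClusterStep (F.P K) 𝔸 M k) (Wk : Set (Fin (k + 1) → ℝ))
    (sp : (domSys (F.P K) M (k + 1)).Dom → Set (CPair (F.P K) 𝔸)) {A R r₁ κ : ℝ} (ℓ : Fin (k + 1) → ℝ)
    (hA : 0 < A) (hr₁ : 0 ≤ r₁) (hκ : κ ≤ r₁) (hrate : r₁ + 2 * (64 * Real.log 162) + 2 ≤ R)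
    (hsmall : 2 * A * Real.exp (5 * r₁ + 1) * K₀ 64 8 * 9 * 64 ≤ 1) (hℓ : ∀ i, 0 ≤ ℓ i)
    (h238 : S.Bound238 Wk sp A R) (hYL : S.YoungLipschitz Wk sp ℓ R)
    {hist hist' : Fin (k + 1) → ℝ} (hh : hist ∈ Wk) (hh' : hist' ∈ Wk) (X : (domSys (F.P K) M (k + 1)).Dom)
    {φ : CPair (F.P K) 𝔸} (hφ : ∀ Z : (domSys (F.P K) M (k + 1)).Dom, Z.1 ⊆ X.1 → φ ∈ sp Z) :
    ‖S.E hist φ X - S.E hist' φ X‖ ≤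
      Real.exp (-(κ * torusTreeLen X.1)) * (8 * (Real.exp 1 * 9 * 64 * K₀ 64 8 ^ 2) * ∑ i, ℓ i * |hist i - hist' i|) := by
  have hK : 0 < K₀ 64 8 := K₀_pos 64 8
  have hM : 0 ≤ Real.exp 1 * 9 * 64 * K₀ 64 8 ^ 2 := by positivity
  have hexp : Real.exp (-(r₁ * torusTreeLen X.1)) ≤ Real.exp (-(κ * torusTreeLen X.1)) :=
    Real.exp_le_exp.2 (neg_le_neg (mul_le_mul_of_nonneg_right hκ (torusTreeLen_nonneg _)))
  set L : ℝ := ∑ i, ℓ i * |hist i - hist' i| with hL_def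
  have hL0 : 0 ≤ L := Finset.sum_nonneg fun i _ => mul_nonneg (hℓ i) (abs_nonneg _)
  have hA0 : A ≠ 0 := hA.ne'
  have halg : ∀ e : ℝ, 8 * (L / A) * (Real.exp 1 * 9 * 64 * K₀ 64 8 ^ 2 * A * e) = e * (8 * (Real.exp 1 * 9 * 64 * K₀ 64 8 ^ 2) * L) := by
    intro e; field_simp
  have hdiv : ∀ e : ℝ, L / A * (A * e) = e * L := by
    intro e; field_simp
  -- the two activity families of step k at the two prefixes, under ONE majorant, differing by `(L∕A)`·majorant inside `X`
  have hwA : ∀ Z : (domSys (F.P K) M (k + 1)).Dom, Z.1 ⊆ X.1 → ‖(fun Z => S.H hist φ Z) Z‖ ≤ A * Real.exp (-(R * torusTreeLen Z.1)) :=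
    fun Z hZ => h238 _ hh Z _ (hφ Z hZ)
  have hwB : ∀ Z : (domSys (F.P K) M (k + 1)).Dom, Z.1 ⊆ X.1 → ‖(fun Z => S.H hist' φ Z) Z‖ ≤ A * Real.exp (-(R * torusTreeLen Z.1)) :=
    fun Z hZ => h238 _ hh' Z _ (hφ Z hZ)
  have hAB : ∀ Z : (domSys (F.P K) M (k + 1)).Dom, Z.1 ⊆ X.1 →
      ‖(fun Z => S.H hist φ Z) Z - (fun Z => S.H hist' φ Z) Z‖ ≤ L / A * (A * Real.exp (-(R * torusTreeLen Z.1))) := by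
    intro Z hZ
    rw [hdiv]
    exact hYL _ hh _ hh' Z _ (hφ Z hZ)
  have key := norm_locE_sub_locE_le_torus4 (N := domCount (F.P K) M (k + 1)) (wA := fun Z => S.H hist φ Z) (wB := fun Z => S.H hist' φ Z) X hA.le hr₁
    (div_nonneg hL0 hA.le) hrate hsmall hwA hwB hAB
  -- the (2.13) representation is `rfl` (W1 `ClusterStep.E_eq_locE`)
  have e1 : S.E hist φ X = locE (TTouch (d := 4) (N := domCount (F.P K) M (k + 1))) (fun Z : (tsys 4 (domCount (F.P K) M (k + 1))).Dom => Z.1)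
      (fun Z => S.H hist φ Z) X.1 := rfl
  have e2 : S.E hist' φ X = locE (TTouch (d := 4) (N := domCount (F.P K) M (k + 1))) (fun Z : (tsys 4 (domCount (F.P K) M (k + 1))).Dom => Z.1)
      (fun Z => S.H hist' φ Z) X.1 := rfl
  rw [e1, e2]
  calc ‖locE (TTouch (d := 4) (N := domCount (F.P K) M (k + 1))) (fun Z : (tsys 4 (domCount (F.P K) M (k + 1))).Dom => Z.1) (fun Z => S.H hist φ Z) X.1 -
        locE (TTouch (d := 4) (N := domCount (F.P K) M (k + 1))) (fun Z : (tsys 4 (domCount (F.P K) M (k + 1))).Dom => Z.1) (fun Z => S.H hist' φ Z) X.1‖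
      ≤ 8 * (L / A) * (Real.exp 1 * 9 * 64 * K₀ 64 8 ^ 2 * A * Real.exp (-(r₁ * torusTreeLen X.1))) := key
    _ = Real.exp (-(r₁ * torusTreeLen X.1)) * (8 * (Real.exp 1 * 9 * 64 * K₀ 64 8 ^ 2) * L) := halg _
    _ ≤ Real.exp (-(κ * torusTreeLen X.1)) * (8 * (Real.exp 1 * 9 * 64 * K₀ 64 8 ^ 2) * L) :=
        mul_le_mul_of_nonneg_right hexp (mul_nonneg (mul_nonneg (by norm_num) hM) hL0)

/-! ## §2 = J29's law (N): the bound on the complexified probe ball through a reading mapping the ball into the admissible spaces -/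

/-- **LAW (N) OF J29 FROM THE SLOTS.**  If a complexified probe reading `Φ : Ec → Φ-pairs` maps the ball `ball 0 r` into the admissible space of every
polymer inside `X`, then the two holomorphic readings `z ↦ E^{(k+1)}(X; hist; Φ z)`, `z ↦ E^{(k+1)}(X; hist′; Φ z)` differ on the ball by at most
`M(X) := e^{−κ d_{k+1}(X)}·8·e·9·64·K₀(64,8)²·Σ_i ℓ_i|hist_i − hist′_i|` — J29's hypothesis `hM` in the shape `wt X · D`.
[cite: Balaban1988RG2Cluster, (2.39)-(2.41) p.21; Balaban1987RG1, (1.20) p.264] -/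
theorem norm_clusterStepE_comp_sub_le_of_youngLipschitz (S : ClusterStep (F.P K) 𝔸 M k) (Wk : Set (Fin (k + 1) → ℝ))
    (sp : (domSys (F.P K) M (k + 1)).Dom → Set (CPair (F.P K) 𝔸)) {A R r₁ κ : ℝ} (ℓ : Fin (k + 1) → ℝ)
    (hA : 0 < A) (hr₁ : 0 ≤ r₁) (hκ : κ ≤ r₁) (hrate : r₁ + 2 * (64 * Real.log 162) + 2 ≤ R)
    (hsmall : 2 * A * Real.exp (5 * r₁ + 1) * K₀ 64 8 * 9 * 64 ≤ 1) (hℓ : ∀ i, 0 ≤ ℓ i)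
    (h238 : S.Bound238 Wk sp A R) (hYL : S.YoungLipschitz Wk sp ℓ R)
    {hist hist' : Fin (k + 1) → ℝ} (hh : hist ∈ Wk) (hh' : hist' ∈ Wk) (X : (domSys (F.P K) M (k + 1)).Dom)
    {Ec : Type*} [NormedAddCommGroup Ec] [NormedSpace ℂ Ec] (Φ : Ec → CPair (F.P K) 𝔸) {r : ℝ}
    (hΦ : ∀ z ∈ ball (0 : Ec) r, ∀ Z : (domSys (F.P K) M (k + 1)).Dom, Z.1 ⊆ X.1 → Φ z ∈ sp Z) :
    ∀ z ∈ ball (0 : Ec) r, ‖S.E hist (Φ z) X - S.E hist' (Φ z) X‖ ≤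
      (Real.exp (-(κ * torusTreeLen X.1)) * (8 * (Real.exp 1 * 9 * 64 * K₀ 64 8 ^ 2))) * ∑ i, ℓ i * |hist i - hist' i| :=
  fun z hz => (norm_clusterStepE_sub_le_of_youngLipschitz F K S Wk sp ℓ hA hr₁ hκ hrate hsmall hℓ h238 hYL hh hh' X (hΦ z hz)).trans_eq (by ring)

end Engine

/-! ## §3 J29's soft windowed bound of the localized sum with (N) discharged modulo the slots -/

variable {V : Type*} [NormedAddCommGroup V] [NormedSpace ℝ V] {ι' : Type*} [Fintype ι']
  {𝔸 : Type*} [NormedRing 𝔸] [NormedAlgebra ℝ 𝔸] {M : ℕ} (F : T4Family)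
  (S : (K : ℕ) → ClusterTower (F.P K) 𝔸 M) (emb : ReadingMaps F 𝔸 𝔸) (ρ : V →L[ℝ] 𝔸) (bV : Module.Basis ι' ℝ V)
  (k K : ℕ) {Ec : Type*} [NormedAddCommGroup Ec] [NormedSpace ℂ Ec]

open Classical in
/-- **★ THE SOFT WINDOWED HISTORY-LIPSCHITZ BOUND OF THE (1.7) LOCALIZED SUM WITH LAW (N) FROM W1's SLOTS.**  For node00-def-W1's term family
`localizedSum F S emb` (probe fields valued in the configuration algebra `𝔸` itself), a set `Wk` of young-coupling prefixes with two members `hist, hist′`,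
space tables `sp` carrying W1's DISPLAYED slots `Bound238 ((S K) k) Wk sp A R` and `YoungLipschitz ((S K) k) Wk sp ℓ R` with Road 1's numerals; and, per
term `X`, a complexified probe reading `Φ X : Ec → Φ-pairs` through a real-linear complexification `ι X` of the probe fields with SITE WEIGHTS
`‖ι X e_{l,t,c}‖ ≤ w X t` (`w ≥ 0`), which (C2) EXTENDS the reading of the exponential chart — `Φ X (ι X B) = emb K k (exp ρB)` — and maps the ball
`ball 0 r` into the admissible space of every polymer inside `X`, with (C1) `z ↦ E^{(k+1)}(X; hist; Φ X z)` and `z ↦ E^{(k+1)}(X; hist′; Φ X z)` holomorphic on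
an open `U X ⊇ ball 0 r`: THEN def-B's windowed kernel (1.21) of the localized sum at separation `z` differs between the two histories by at most
`Σ_X 16·(c·e^{−κ d_{k+1}(X)}·Σ_i ℓ_i|hist_i − hist′_i|)·r⁻²·w_X(z·)·w_X(0·)`, `c = 8·e·9·64·K₀(64,8)²` — J29's `abs_polWindow_localizedSum_sub_le_soft` with
its law (N) supplied by §2; the summand is what dag-n22-w2's (5.10) polymer resummation turns into `C·e^{−δ₁|z|₁}·Σ_i Λ_i|hist_i − hist′_i|`.
[cite: Balaban1987RG1, (1.7) p.261, (1.20)-(1.21) p.264, (4.35)-(4.37) pp.290-291 and (5.10) p.293; Balaban1988RG2Cluster, (2.13) p.14, (2.38) p.20 and (2.39)-(2.41) p.21] -/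
theorem abs_polWindow_localizedSum_sub_le_soft_of_slots
    (Wk : Set (Fin (k + 1) → ℝ)) (sp : (domSys (F.P K) M (k + 1)).Dom → Set (CPair (F.P K) 𝔸)) {A R r₁ κ : ℝ} (ℓ : Fin (k + 1) → ℝ)
    (hA : 0 < A) (hr₁ : 0 ≤ r₁) (hκ : κ ≤ r₁) (hrate : r₁ + 2 * (64 * Real.log 162) + 2 ≤ R)
    (hsmall : 2 * A * Real.exp (5 * r₁ + 1) * K₀ 64 8 * 9 * 64 ≤ 1) (hℓ : ∀ i, 0 ≤ ℓ i)
    (h238 : ((S K) k).Bound238 Wk sp A R) (hYL : ((S K) k).YoungLipschitz Wk sp ℓ R)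
    {hist hist' : Fin (k + 1) → ℝ} (hh : hist ∈ Wk) (hh' : hist' ∈ Wk)
    (ι : (domSys (F.P K) M (k + 1)).Dom → ((Fin (F.P K).d → Site (F.P K) (k + 1) → V) →L[ℝ] Ec))
    (Φ : (domSys (F.P K) M (k + 1)).Dom → Ec → CPair (F.P K) 𝔸)
    (U : (domSys (F.P K) M (k + 1)).Dom → Set Ec) (hU : ∀ X, IsOpen (U X)) {r : ℝ} (hr : 0 < r) (hrU : ∀ X, ball (0 : Ec) r ⊆ U X)
    (hΦhol : ∀ X, DifferentiableOn ℂ (fun z => ((S K) k).E hist (Φ X z) X) (U X))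
    (hΦhol' : ∀ X, DifferentiableOn ℂ (fun z => ((S K) k).E hist' (Φ X z) X) (U X))
    (hΦemb : ∀ X (B : Fin (F.P K).d → Site (F.P K) (k + 1) → V), Φ X (ι X B) = emb K k (fun l t => NormedSpace.exp (ρ (B l t))))
    (hΦsp : ∀ X, ∀ z ∈ ball (0 : Ec) r, ∀ Z : (domSys (F.P K) M (k + 1)).Dom, Z.1 ⊆ X.1 → Φ X z ∈ sp Z)
    (w : (domSys (F.P K) M (k + 1)).Dom → Site (F.P K) (k + 1) → ℝ)
    (hw₀ : ∀ X t, 0 ≤ w X t) (hw : ∀ X (l : Fin (F.P K).d) (t : Site (F.P K) (k + 1)) (c : ι'), ‖ι X (Pi.single l (Pi.single t (bV c)))‖ ≤ w X t)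
    (μ ν : Fin 4) (z : Fin 4 → ℤ) :
    |polWindow F K (k + 1) (localizedSum F S emb k hist K) ρ bV μ ν z - polWindow F K (k + 1) (localizedSum F S emb k hist' K) ρ bV μ ν z| ≤
      ∑ X : (domSys (F.P K) M (k + 1)).Dom,
        16 * ((Real.exp (-(κ * torusTreeLen X.1)) * (8 * (Real.exp 1 * 9 * 64 * K₀ 64 8 ^ 2))) * ∑ i, ℓ i * |hist i - hist' i|) / r ^ 2 *
          (w X (siteOfInt F K (k + 1) z) * w X (siteOfInt F K (k + 1) 0)) :=
  abs_polWindow_localizedSum_sub_le_soft F S emb ρ bV k K hist hist' ι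
    (fun X z => ((S K) k).E hist (Φ X z) X) (fun X z => ((S K) k).E hist' (Φ X z) X) U hU hΦhol hΦhol' hr hrU
    (fun X B => by rw [expChart_apply, hΦemb])
    (fun X B => by rw [expChart_apply, hΦemb])
    (fun X => (Real.exp (-(κ * torusTreeLen X.1)) * (8 * (Real.exp 1 * 9 * 64 * K₀ 64 8 ^ 2))) * ∑ i, ℓ i * |hist i - hist' i|)
    (fun X => norm_clusterStepE_comp_sub_le_of_youngLipschitz F K ((S K) k) Wk sp ℓ hA hr₁ hκ hrate hsmall hℓ h238 hYL hh hh' X (Φ X) (hΦsp X))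
    w hw₀ hw μ ν z

/-! ## v1.1 (append-only) — (C1) AND THE VALUE LAW FROM ACTIVITY-LEVEL HOLOMORPHY THROUGH THE COMPLEXIFIED READING (S25's parametric
Kotecký–Preiss engine `analytic_and_bounded_locE_param_torus` BY NAME): the residual displayed laws all sit at W1's ACTIVITY level -/

section ActivitySlots

open Summit.QuantumFields.BalabanUV.T4Continuum.NE1p.DressedOutputAnalyticFaces (analytic_and_bounded_locE_param_torus)

variable (F : T4Family) (K : ℕ) {𝔸 : Type*} {M k : ℕ}

open Classical in
/-- **(C1) + THE VALUE LAW OF THE (2.13) TERM THROUGH A COMPLEXIFIED READING, FROM THE ACTIVITIES.**  For W1's one-step data `S` at level `k`, a prefix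
`hist ∈ Wk`, space tables `sp` with W1's DISPLAYED `Bound238 S Wk sp A R`, Road 1's numerals (single smallness `A·e^{5r₁+1}·K₀(64,8)·9·64 ≤ 1`), and a map
`Φ : Ec → Φ-pairs` on an OPEN `U` of a complex normed space such that every activity `z ↦ H(Z; hist; Φ z)`, `Z ⊆ X`, is holomorphic on `U` ([II] p. 15:
the activities are analytic functions of `(𝐔, 𝐉)` on the spaces — composed with a holomorphic reading) and `Φ` maps `U` into the admissible space of every
polymer inside `X`: the (2.13) term `z ↦ E^{(k+1)}(X; hist; Φ z)` is HOLOMORPHIC on `U` and bounded there by `e·9·64·K₀(64,8)²·A·e^{−r₁·torusTreeLen X}` —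
S25's parametric Kotecký–Preiss engine at the activity family `z ↦ H(·; hist; Φ z)` under the (2.38) majorant; `ClusterStep.E_eq_locE` by `rfl`.
[cite: Balaban1988RG2Cluster, (2.13) p.14, p.15 (analyticity of the activities), (2.38) p.20 and (2.41) p.21] -/
theorem differentiableOn_and_norm_clusterStepE_comp_le_of_activityHol (S : ClusterStep (F.P K) 𝔸 M k) (Wk : Set (Fin (k + 1) → ℝ))
    (sp : (domSys (F.P K) M (k + 1)).Dom → Set (CPair (F.P K) 𝔸)) {A R r₁ : ℝ}
    (hA : 0 ≤ A) (hr₁ : 0 ≤ r₁) (hrate : r₁ + 2 * (64 * Real.log 162) + 2 ≤ R) (hsmall : A * Real.exp (5 * r₁ + 1) * K₀ 64 8 * 9 * 64 ≤ 1)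
    (h238 : S.Bound238 Wk sp A R) {hist : Fin (k + 1) → ℝ} (hh : hist ∈ Wk) (X : (domSys (F.P K) M (k + 1)).Dom)
    {Ec : Type*} [NormedAddCommGroup Ec] [NormedSpace ℂ Ec] (Φ : Ec → CPair (F.P K) 𝔸) {U : Set Ec} (hU : IsOpen U)
    (hHhol : ∀ Z : (domSys (F.P K) M (k + 1)).Dom, Z.1 ⊆ X.1 → DifferentiableOn ℂ (fun z => S.H hist (Φ z) Z) U)
    (hΦ : ∀ z ∈ U, ∀ Z : (domSys (F.P K) M (k + 1)).Dom, Z.1 ⊆ X.1 → Φ z ∈ sp Z) :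
    DifferentiableOn ℂ (fun z => S.E hist (Φ z) X) U ∧
      ∀ z ∈ U, ‖S.E hist (Φ z) X‖ ≤ Real.exp 1 * 9 * 64 * K₀ 64 8 ^ 2 * A * Real.exp (-(r₁ * torusTreeLen X.1)) :=
  analytic_and_bounded_locE_param_torus (N := domCount (F.P K) M (k + 1)) (P := Ec)
    (m := fun Z : (tsys 4 (domCount (F.P K) M (k + 1))).Dom => A * Real.exp (-(R * torusTreeLen Z.1))) (act := fun z Z => S.H hist (Φ z) Z)
    (A := A) (R := R) (r₁ := r₁) X hU hA hr₁ hrate hsmall hHhol (fun z hz Z hZ => h238 _ hh Z _ (hΦ z hz Z hZ)) (fun _ _ => le_rfl)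

end ActivitySlots

section ValueAndDifference

variable {V : Type*} [NormedAddCommGroup V] [NormedSpace ℝ V] {ι' : Type*} [Fintype ι']
  {𝔸 : Type*} [NormedRing 𝔸] [NormedAlgebra ℝ 𝔸] {M : ℕ} (F : T4Family)
  (S : (K : ℕ) → ClusterTower (F.P K) 𝔸 M) (emb : ReadingMaps F 𝔸 𝔸) (ρ : V →L[ℝ] 𝔸) (bV : Module.Basis ι' ℝ V)
  (k K : ℕ) {Ec : Type*} [NormedAddCommGroup Ec] [NormedSpace ℂ Ec]

open Classical in
/-- **★ THE SOFT WINDOWED BOUND OF THE (1.7) LOCALIZED SUM — VALUE, WITH (C) AND THE VALUE LAW FROM THE ACTIVITIES.**  At ONE coupling history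
`hist ∈ Wk`: W1's DISPLAYED `Bound238 ((S K) k) Wk sp A R` with Road 1's numerals (single smallness), per-term complexified probe readings `Φ X : Ec → Φ-pairs`
on open `U X ⊇ ball 0 r` through real-linear `ι X` with site weights `‖ι X e_{l,t,c}‖ ≤ w X t` (`w ≥ 0`), every activity `z ↦ H(Z; hist; Φ X z)`, `Z ⊆ X`,
holomorphic on `U X`, `Φ X (ι X B) = emb K k (exp ρB)` and `Φ X (U X) ⊆ sp Z` for `Z ⊆ X` ⟹ def-B's windowed kernel (1.21) of `localizedSum F S emb` at
separation `z` is at most `Σ_X 16·(e·9·64·K₀(64,8)²·A·e^{−r₁·torusTreeLen X})·r⁻²·w_X(z·)·w_X(0·)` — J29 v1.1's `abs_polWindow_localizedSum_le_soft` with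
(C) and `‖G X‖ ≤ M X` supplied by `differentiableOn_and_norm_clusterStepE_comp_le_of_activityHol`; the summand is dag-n22-w2's
`windowedDecay_localizedSum_of_softSum` input. [cite: Balaban1987RG1, (1.7) p.261, (1.18) p.263, (1.20)-(1.21) p.264 and (5.10) p.293; Balaban1988RG2Cluster, (2.13) p.14, (2.38) p.20 and (2.41) p.21] -/
theorem abs_polWindow_localizedSum_le_soft_of_activitySlots
    (Wk : Set (Fin (k + 1) → ℝ)) (sp : (domSys (F.P K) M (k + 1)).Dom → Set (CPair (F.P K) 𝔸)) {A R r₁ : ℝ}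
    (hA : 0 ≤ A) (hr₁ : 0 ≤ r₁) (hrate : r₁ + 2 * (64 * Real.log 162) + 2 ≤ R) (hsmall : A * Real.exp (5 * r₁ + 1) * K₀ 64 8 * 9 * 64 ≤ 1)
    (h238 : ((S K) k).Bound238 Wk sp A R) {hist : Fin (k + 1) → ℝ} (hh : hist ∈ Wk)
    (ι : (domSys (F.P K) M (k + 1)).Dom → ((Fin (F.P K).d → Site (F.P K) (k + 1) → V) →L[ℝ] Ec))
    (Φ : (domSys (F.P K) M (k + 1)).Dom → Ec → CPair (F.P K) 𝔸)
    (U : (domSys (F.P K) M (k + 1)).Dom → Set Ec) (hU : ∀ X, IsOpen (U X)) {r : ℝ} (hr : 0 < r) (hrU : ∀ X, ball (0 : Ec) r ⊆ U X)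
    (hHhol : ∀ X (Z : (domSys (F.P K) M (k + 1)).Dom), Z.1 ⊆ X.1 → DifferentiableOn ℂ (fun z => ((S K) k).H hist (Φ X z) Z) (U X))
    (hΦemb : ∀ X (B : Fin (F.P K).d → Site (F.P K) (k + 1) → V), Φ X (ι X B) = emb K k (fun l t => NormedSpace.exp (ρ (B l t))))
    (hΦsp : ∀ X, ∀ z ∈ U X, ∀ Z : (domSys (F.P K) M (k + 1)).Dom, Z.1 ⊆ X.1 → Φ X z ∈ sp Z)
    (w : (domSys (F.P K) M (k + 1)).Dom → Site (F.P K) (k + 1) → ℝ)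
    (hw₀ : ∀ X t, 0 ≤ w X t) (hw : ∀ X (l : Fin (F.P K).d) (t : Site (F.P K) (k + 1)) (c : ι'), ‖ι X (Pi.single l (Pi.single t (bV c)))‖ ≤ w X t)
    (μ ν : Fin 4) (z : Fin 4 → ℤ) :
    |polWindow F K (k + 1) (localizedSum F S emb k hist K) ρ bV μ ν z| ≤
      ∑ X : (domSys (F.P K) M (k + 1)).Dom,
        16 * (Real.exp 1 * 9 * 64 * K₀ 64 8 ^ 2 * A * Real.exp (-(r₁ * torusTreeLen X.1))) / r ^ 2 *
          (w X (siteOfInt F K (k + 1) z) * w X (siteOfInt F K (k + 1) 0)) := by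
  have key := fun X => differentiableOn_and_norm_clusterStepE_comp_le_of_activityHol F K ((S K) k) Wk sp hA hr₁ hrate hsmall h238 hh X (Φ X) (hU X)
    (hHhol X) (hΦsp X)
  exact abs_polWindow_localizedSum_le_soft F S emb ρ bV k K hist ι (fun X z => ((S K) k).E hist (Φ X z) X) U hU (fun X => (key X).1) hr hrU
    (fun X B => by rw [expChart_apply, hΦemb]) (fun X => Real.exp 1 * 9 * 64 * K₀ 64 8 ^ 2 * A * Real.exp (-(r₁ * torusTreeLen X.1)))
    (fun X z hz => (key X).2 z (hrU X hz)) w hw₀ hw μ ν z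

open Classical in
/-- **★ THE SOFT WINDOWED HISTORY-LIPSCHITZ BOUND OF THE (1.7) LOCALIZED SUM WITH (N) AND (C1) FROM THE ACTIVITIES.**  J30's
`abs_polWindow_localizedSum_sub_le_soft_of_slots` with its hypothesis (C1) «`z ↦ E^{(k+1)}(X; hist; Φ X z)` holomorphic on `U X`» (both histories) DISCHARGED from
activity-level holomorphy through the complexified reading (`differentiableOn_and_norm_clusterStepE_comp_le_of_activityHol`); what stays displayed is all at
W1's ACTIVITY level — `Bound238`, `YoungLipschitz`, holomorphy of `z ↦ H(Z; hist; Φ X z)` on `U X` — plus the complexified reading `Φ X` itself (extends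
`emb K k ∘ exp ρ`, maps `U X` into the spaces) and the site weights. [cite: Balaban1987RG1, (1.7) p.261, (1.20)-(1.21) p.264, (4.35)-(4.37) pp.290-291 and (5.10) p.293; Balaban1988RG2Cluster, (2.13) p.14, p.15, (2.38) p.20 and (2.39)-(2.41) p.21] -/
theorem abs_polWindow_localizedSum_sub_le_soft_of_activitySlots
    (Wk : Set (Fin (k + 1) → ℝ)) (sp : (domSys (F.P K) M (k + 1)).Dom → Set (CPair (F.P K) 𝔸)) {A R r₁ κ : ℝ} (ℓ : Fin (k + 1) → ℝ)
    (hA : 0 < A) (hr₁ : 0 ≤ r₁) (hκ : κ ≤ r₁) (hrate : r₁ + 2 * (64 * Real.log 162) + 2 ≤ R)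
    (hsmall : 2 * A * Real.exp (5 * r₁ + 1) * K₀ 64 8 * 9 * 64 ≤ 1) (hℓ : ∀ i, 0 ≤ ℓ i)
    (h238 : ((S K) k).Bound238 Wk sp A R) (hYL : ((S K) k).YoungLipschitz Wk sp ℓ R)
    {hist hist' : Fin (k + 1) → ℝ} (hh : hist ∈ Wk) (hh' : hist' ∈ Wk)
    (ι : (domSys (F.P K) M (k + 1)).Dom → ((Fin (F.P K).d → Site (F.P K) (k + 1) → V) →L[ℝ] Ec))
    (Φ : (domSys (F.P K) M (k + 1)).Dom → Ec → CPair (F.P K) 𝔸)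
    (U : (domSys (F.P K) M (k + 1)).Dom → Set Ec) (hU : ∀ X, IsOpen (U X)) {r : ℝ} (hr : 0 < r) (hrU : ∀ X, ball (0 : Ec) r ⊆ U X)
    (hHhol : ∀ X (Z : (domSys (F.P K) M (k + 1)).Dom), Z.1 ⊆ X.1 → DifferentiableOn ℂ (fun z => ((S K) k).H hist (Φ X z) Z) (U X))
    (hHhol' : ∀ X (Z : (domSys (F.P K) M (k + 1)).Dom), Z.1 ⊆ X.1 → DifferentiableOn ℂ (fun z => ((S K) k).H hist' (Φ X z) Z) (U X))
    (hΦemb : ∀ X (B : Fin (F.P K).d → Site (F.P K) (k + 1) → V), Φ X (ι X B) = emb K k (fun l t => NormedSpace.exp (ρ (B l t))))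
    (hΦsp : ∀ X, ∀ z ∈ U X, ∀ Z : (domSys (F.P K) M (k + 1)).Dom, Z.1 ⊆ X.1 → Φ X z ∈ sp Z)
    (w : (domSys (F.P K) M (k + 1)).Dom → Site (F.P K) (k + 1) → ℝ)
    (hw₀ : ∀ X t, 0 ≤ w X t) (hw : ∀ X (l : Fin (F.P K).d) (t : Site (F.P K) (k + 1)) (c : ι'), ‖ι X (Pi.single l (Pi.single t (bV c)))‖ ≤ w X t)
    (μ ν : Fin 4) (z : Fin 4 → ℤ) :
    |polWindow F K (k + 1) (localizedSum F S emb k hist K) ρ bV μ ν z - polWindow F K (k + 1) (localizedSum F S emb k hist' K) ρ bV μ ν z| ≤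
      ∑ X : (domSys (F.P K) M (k + 1)).Dom,
        16 * ((Real.exp (-(κ * torusTreeLen X.1)) * (8 * (Real.exp 1 * 9 * 64 * K₀ 64 8 ^ 2))) * ∑ i, ℓ i * |hist i - hist' i|) / r ^ 2 *
          (w X (siteOfInt F K (k + 1) z) * w X (siteOfInt F K (k + 1) 0)) := by
  have hK : 0 < K₀ 64 8 := K₀_pos 64 8
  have hsmall1 : A * Real.exp (5 * r₁ + 1) * K₀ 64 8 * 9 * 64 ≤ 1 := by
    have h0 : 0 ≤ A * Real.exp (5 * r₁ + 1) * K₀ 64 8 * 9 * 64 := by have := hA.le; positivity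
    linarith
  have key := fun (h : Fin (k + 1) → ℝ) (hm : h ∈ Wk) (X : (domSys (F.P K) M (k + 1)).Dom)
      (hH : ∀ Z : (domSys (F.P K) M (k + 1)).Dom, Z.1 ⊆ X.1 → DifferentiableOn ℂ (fun z => ((S K) k).H h (Φ X z) Z) (U X)) =>
    (differentiableOn_and_norm_clusterStepE_comp_le_of_activityHol F K ((S K) k) Wk sp hA.le hr₁ hrate hsmall1 h238 hm X (Φ X) (hU X) hH (hΦsp X)).1
  exact abs_polWindow_localizedSum_sub_le_soft_of_slots F S emb ρ bV k K Wk sp ℓ hA hr₁ hκ hrate hsmall hℓ h238 hYL hh hh' ι Φ U hU hr hrU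
    (fun X => key hist hh X (hHhol X)) (fun X => key hist' hh' X (hHhol' X)) hΦemb (fun X z hz => hΦsp X z (hrU X hz)) w hw₀ hw μ ν z

end ValueAndDifference

end YMDAG.N22.WindowOfLocalTerms

end
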